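import Mathlib
import Summits.AtomisticToContinuum.HydrodynamicLimit.Theorems.ImplosionDichotomyDenseExcursionConeLocality

/-!
# Shrinking-ball locality (domain of dependence with a time-dependent speed bound) — stub
# `stub_shrinkingBallLocality` (L3)

Crux `Summit.AtomisticToContinuum.HydrodynamicLimit.Theses.ImplosionDichotomy.DenseExcursion`
(stmt-AtomisticToContinuum-12586), line `r2-one-mode-two-conditions` (skeleton v8), registered stub
`stub_shrinkingBallLocality : ShrinkingBallLocality`.

**Mathematics.** `ShrinkingBallLocality` is the landed straight-cone domain-of-dependence statement
`KidderKnobMelnikov.HsEulerConeLocality` (`…ConeDefs.lean`, proved as `KidderKnobMelnikov.stub_coneLocality` in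
`…ConeLocality.lean`) for two `C¹` chart solutions of the primitive athermal Euler system `AthermalEulerAt ζ`, with
the constant speed bound `c` replaced by a continuous `c(t) ≥ 0` on `[0, t₁]` and the straight cone
`‖x − x₀‖ + c t < R` by the region `‖x − x₀‖ + ∫₀ᵗ c < R`.

**Proof.** Pure real analysis over the landed lemma, no PDE estimates. Fix `(t, x)` in the region and a margin
`δ > 0` with `‖x − x₀‖ + ∫₀ᵗ c + δ t < R`. We show by REAL INDUCTION on `s ∈ [0, t]` that the two triples agree at
time `s` on the ball `‖y − x₀‖ < R − ∫₀ˢ c − δ s` ("`good s`"):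
* `good 0` is the data hypothesis;
* (open step) if `good s`, `0 ≤ s < t₁`, pick `h > 0` with `|c − c(s)| < δ/2` on `[s, s + h] ⊆ [0, t₁]`
  (continuity of `c`) and restart the straight-cone lemma at time `s` on the TIME-SHIFTED fields
  `(τ, y) ↦ (P, Θ, U)(s + τ, y)` (again `C¹` on the shifted slab, `contDiffOn_timeShift`; the pointwise system is
  autonomous, `athermalEulerAt_timeShift`, Mathlib `deriv_comp_const_add`) with the CONSTANT speed
  `C = c(s) + δ/2 ≥ c`, radius `R − ∫₀ˢ c − δ s`, horizon `h`: the straight cone lies in the region because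
  `∫ₛ^{s+τ} c ≤ C τ`, and it contains the balls of `good (s + τ)` because `∫ₛ^{s+τ} c + δ τ ≥ C τ`;
* (closed step) if `good s'` for all `s' < s` (`0 < s < t₁`) then `good s`, since the radii decrease in time and both
  triples are continuous from the left in time (`eq_of_eqOn_Ico`).
The supremum of `{s ∈ [0, t] | good on [0, s]}` is then `t`, and `good t` at `x` is the claim. (This replaces the
partition/Riemann-sum bookkeeping of the informal plan by its infinitesimal version; only pointwise continuity of `c`
and additivity/monotonicity of the interval integral are used.) Folklore; no cited facts.
-/

noncomputable section

open Set Filter Topology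
open scoped ContDiff

namespace Summit.AtomisticToContinuum.HydrodynamicLimit.Theorems.R2OneModeTwoConditions

open Literature.MathematicalPhysics.KineticTheory
open Literature.Analysis.FunctionSpaces
open Summit.AtomisticToContinuum.HydrodynamicLimit.Theorems.KidderKnobMelnikov (AthermalEulerAt HsEulerConeLocality)

/-- SHRINKING-BALL LOCALITY (domain of dependence with a time-dependent speed bound): the landed straight-cone statement
`HsEulerConeLocality` with the constant speed `c` replaced by a continuous `c(t) ≥ 0` and the cone by the region
`‖x − x₀‖ + ∫₀ᵗ c < R` — two `C¹` chart solutions of `AthermalEulerAt ζ` on that region (densities in the hyperbolicity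
range `[a, b]` of the smooth law `ζ`, positive temperatures), the characteristic speed `‖U₁‖ + c_s(P₁, Θ₁)` of the FIRST
bounded by `c(t)` there, equal data on the ball `‖x − x₀‖ < R` ⇒ equal on the region. (From the straight cones by
restarting on a partition of `[0, t]` with `c_k = max c` on each piece and letting the mesh go to `0`.) This is the form the
heart needs up to the blow-up time, where speeds grow like `(T − t)^{1/r−1}` (integrable). -/
def ShrinkingBallLocality : Prop :=
  ∀ (ζ : ℝ → ℝ) (J : Set ℝ) (a b : ℝ), IsOpen J → ContDiffOn ℝ ∞ ζ J → Set.Icc a b ⊆ J → 0 < a →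
    (∀ r ∈ Set.Icc a b, 0 < ζ r + r * deriv ζ r) →
  ∀ (P₁ Θ₁ P₂ Θ₂ : ℝ → V3 → ℝ) (U₁ U₂ : ℝ → V3 → V3) (x₀ : V3) (R t₁ : ℝ) (c : ℝ → ℝ),
    ContDiffOn ℝ 1 (fun p : ℝ × V3 => P₁ p.1 p.2) (Set.Ico 0 t₁ ×ˢ Set.univ) →
    ContDiffOn ℝ 1 (fun p : ℝ × V3 => Θ₁ p.1 p.2) (Set.Ico 0 t₁ ×ˢ Set.univ) →
    ContDiffOn ℝ 1 (fun p : ℝ × V3 => U₁ p.1 p.2) (Set.Ico 0 t₁ ×ˢ Set.univ) →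
    ContDiffOn ℝ 1 (fun p : ℝ × V3 => P₂ p.1 p.2) (Set.Ico 0 t₁ ×ˢ Set.univ) →
    ContDiffOn ℝ 1 (fun p : ℝ × V3 => Θ₂ p.1 p.2) (Set.Ico 0 t₁ ×ˢ Set.univ) →
    ContDiffOn ℝ 1 (fun p : ℝ × V3 => U₂ p.1 p.2) (Set.Ico 0 t₁ ×ˢ Set.univ) →
    ContinuousOn c (Set.Icc 0 t₁) → (∀ t ∈ Set.Icc 0 t₁, 0 ≤ c t) →
    (∀ t ∈ Set.Ico 0 t₁, ∀ x, ‖x - x₀‖ + ∫ s in (0 : ℝ)..t, c s < R →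
      P₁ t x ∈ Set.Icc a b ∧ P₂ t x ∈ Set.Icc a b ∧ 0 < Θ₁ t x ∧ 0 < Θ₂ t x) →
    (∀ t ∈ Set.Ioo 0 t₁, ∀ x, ‖x - x₀‖ + ∫ s in (0 : ℝ)..t, c s < R →
      AthermalEulerAt ζ P₁ Θ₁ U₁ t x ∧ AthermalEulerAt ζ P₂ Θ₂ U₂ t x) →
    (∀ t ∈ Set.Ioo 0 t₁, ∀ x, ‖x - x₀‖ + ∫ s in (0 : ℝ)..t, c s < R →
      ‖U₁ t x‖ + Real.sqrt (Θ₁ t x * (ζ (P₁ t x) + P₁ t x * deriv ζ (P₁ t x)) +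
        2 / 3 * Θ₁ t x * ζ (P₁ t x) ^ 2) ≤ c t) →
    (∀ x, ‖x - x₀‖ < R → P₁ 0 x = P₂ 0 x ∧ U₁ 0 x = U₂ 0 x ∧ Θ₁ 0 x = Θ₂ 0 x) →
    ∀ t ∈ Set.Ico 0 t₁, ∀ x, ‖x - x₀‖ + ∫ s in (0 : ℝ)..t, c s < R →
      P₁ t x = P₂ t x ∧ U₁ t x = U₂ t x ∧ Θ₁ t x = Θ₂ t x

/-! ## Time shifts and left-continuity -/

/-- Time shift of a jointly `C¹` field: if `(s, y) ↦ f s y` is `C¹` on the slab `[0, t₁) × ℝ³`, `0 ≤ s₀` and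
`s₀ + h ≤ t₁`, then `(s, y) ↦ f (s₀ + s) y` is `C¹` on the slab `[0, h) × ℝ³` (composition with the affine map
`(s, y) ↦ (s₀ + s, y)`, which maps the second slab into the first). -/
theorem contDiffOn_timeShift {E : Type*} [NormedAddCommGroup E] [NormedSpace ℝ E] {f : ℝ → V3 → E}
    {t₁ s₀ h : ℝ} (hs₀ : 0 ≤ s₀) (hh : s₀ + h ≤ t₁)
    (hf : ContDiffOn ℝ 1 (fun p : ℝ × V3 => f p.1 p.2) (Set.Ico 0 t₁ ×ˢ Set.univ)) :
    ContDiffOn ℝ 1 (fun p : ℝ × V3 => f (s₀ + p.1) p.2) (Set.Ico 0 h ×ˢ Set.univ) := by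
  have hg : ContDiff ℝ 1 (fun p : ℝ × V3 => (s₀ + p.1, p.2)) :=
    (contDiff_const.add contDiff_fst).prodMk contDiff_snd
  refine hf.comp hg.contDiffOn ?_
  intro p hp
  simp only [Set.mem_prod, Set.mem_Ico, Set.mem_univ, and_true] at hp ⊢
  exact ⟨by linarith [hp.1], by linarith [hp.2]⟩

/-- The chart system is autonomous: the time-shifted fields `(r, y) ↦ (P, Θ, U) (s₀ + r) y` solve
`AthermalEulerAt ζ` at `(s, x)` iff the original fields solve it at `(s₀ + s, x)` (time derivatives by Mathlib's
`deriv_comp_const_add`; all space derivatives are taken slice-wise, so they are literally the same). -/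
theorem athermalEulerAt_timeShift (ζ : ℝ → ℝ) (P Θ : ℝ → V3 → ℝ) (U : ℝ → V3 → V3) (s₀ s : ℝ) (x : V3) :
    AthermalEulerAt ζ (fun r y => P (s₀ + r) y) (fun r y => Θ (s₀ + r) y) (fun r y => U (s₀ + r) y) s x ↔
      AthermalEulerAt ζ P Θ U (s₀ + s) x := by
  unfold AthermalEulerAt
  rw [deriv_comp_const_add (fun r => P r x) s₀ s, deriv_comp_const_add (fun r => U r x) s₀ s,
    deriv_comp_const_add (fun r => Θ r x) s₀ s]

/-- Left-continuity in time passes agreement to the endpoint: if `(s, y) ↦ f s y` and `(s, y) ↦ g s y` are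
continuous on the slab `[0, t₁) × ℝ³`, `0 < s < t₁`, and `f s' y = g s' y` for all `0 ≤ s' < s` at a fixed `y`, then
`f s y = g s y`. -/
theorem eq_of_eqOn_Ico {E : Type*} [TopologicalSpace E] [T2Space E] {f g : ℝ → V3 → E} {t₁ s : ℝ} {y : V3}
    (hf : ContinuousOn (fun p : ℝ × V3 => f p.1 p.2) (Set.Ico 0 t₁ ×ˢ Set.univ))
    (hg : ContinuousOn (fun p : ℝ × V3 => g p.1 p.2) (Set.Ico 0 t₁ ×ˢ Set.univ))
    (hs : s ∈ Set.Ioo 0 t₁) (h : ∀ s' ∈ Set.Ico 0 s, f s' y = g s' y) : f s y = g s y := by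
  have hmaps : Set.MapsTo (fun s' : ℝ => (s', y)) (Set.Icc 0 s) (Set.Ico 0 t₁ ×ˢ Set.univ) :=
    fun s' hs' => ⟨⟨hs'.1, hs'.2.trans_lt hs.2⟩, Set.mem_univ _⟩
  have hγ : Continuous fun s' : ℝ => (s', y) := Continuous.prodMk_left y
  have hfc : ContinuousOn (fun s' => f s' y) (Set.Icc 0 s) := hf.comp hγ.continuousOn hmaps
  have hgc : ContinuousOn (fun s' => g s' y) (Set.Icc 0 s) := hg.comp hγ.continuousOn hmaps
  have key : Set.EqOn (fun s' => f s' y) (fun s' => g s' y) (Set.Icc 0 s) :=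
    Set.EqOn.of_subset_closure (fun s' hs' => h s' hs') hfc hgc Set.Ico_subset_Icc_self
      (by rw [closure_Ico hs.1.ne])
  exact key ⟨hs.1.le, le_rfl⟩

/-! ## The registered stub -/

/-- **Shrinking-ball locality** (registered stub `stub_shrinkingBallLocality`, L3, of line
`r2-one-mode-two-conditions`): `ShrinkingBallLocality` holds — domain of dependence for two `C¹` chart solutions of
`AthermalEulerAt ζ` with a continuous time-dependent speed bound `c(t) ≥ 0`, on the region `‖x − x₀‖ + ∫₀ᵗ c < R`.
Derived from the landed straight-cone statement `KidderKnobMelnikov.stub_coneLocality : HsEulerConeLocality` by real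
induction in time: restart the straight cone at time `s` on the time-shifted fields with the constant speed
`c(s) + δ/2` on a short piece where `|c − c(s)| < δ/2`, and pass to limit times by left-continuity; the margin
`δ t < R − ‖x − x₀‖ − ∫₀ᵗ c` absorbs the excess of the piecewise-constant speeds over `∫ c`. [folklore] -/
theorem stub_shrinkingBallLocality : ShrinkingBallLocality := by
  intro ζ J a b hJ hζ hab ha hγ P₁ Θ₁ P₂ Θ₂ U₁ U₂ x₀ R t₁ c hP₁ hΘ₁ hU₁ hP₂ hΘ₂ hU₂ hcc hc0 hrange hE hspeed h0
    t ht x hx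
  -- integrability of `c` on subintervals of `[0, t₁]`
  have hint : ∀ u v : ℝ, 0 ≤ u → u ≤ v → v ≤ t₁ → IntervalIntegrable c MeasureTheory.volume u v :=
    fun u v hu huv hv =>
      (hcc.mono (by rw [Set.uIcc_of_le huv]; exact Set.Icc_subset_Icc hu hv)).intervalIntegrable
  -- additivity of the primitive
  have hadd : ∀ u v : ℝ, 0 ≤ u → u ≤ v → v ≤ t₁ →
      ∫ r in (0 : ℝ)..v, c r = (∫ r in (0 : ℝ)..u, c r) + ∫ r in u..v, c r :=
    fun u v hu huv hv =>
      (intervalIntegral.integral_add_adjacent_intervals (hint 0 u le_rfl hu (huv.trans hv))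
        (hint u v hu huv hv)).symm
  /- STEP: the straight-cone lemma restarted at time `s₀` with constant speed `C ≥ c` on `[s₀, s₀ + h]`, radius `ρ`
  with `ρ + ∫₀^{s₀} c ≤ R` (so that the straight cone lies in the region), from agreement on the ball of radius `ρ`
  at time `s₀`. -/
  have step : ∀ s₀ ρ C h : ℝ, 0 ≤ s₀ → 0 < h → s₀ + h ≤ t₁ → 0 ≤ C →
      (∀ s ∈ Set.Icc s₀ (s₀ + h), c s ≤ C) → ρ + ∫ r in (0 : ℝ)..s₀, c r ≤ R →
      (∀ y, ‖y - x₀‖ < ρ → P₁ s₀ y = P₂ s₀ y ∧ U₁ s₀ y = U₂ s₀ y ∧ Θ₁ s₀ y = Θ₂ s₀ y) →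
      ∀ τ ∈ Set.Ico 0 h, ∀ y, ‖y - x₀‖ + C * τ < ρ →
        P₁ (s₀ + τ) y = P₂ (s₀ + τ) y ∧ U₁ (s₀ + τ) y = U₂ (s₀ + τ) y ∧ Θ₁ (s₀ + τ) y = Θ₂ (s₀ + τ) y := by
    intro s₀ ρ C h hs₀ _hh hht hC hcC hρ hagr
    -- the straight cone from `s₀` lies in the region
    have region : ∀ τ ∈ Set.Ico 0 h, ∀ y : V3, ‖y - x₀‖ + C * τ < ρ →
        ‖y - x₀‖ + ∫ r in (0 : ℝ)..(s₀ + τ), c r < R := by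
      intro τ hτ y hy
      have h1 := hadd s₀ (s₀ + τ) hs₀ (by linarith [hτ.1]) (by linarith [hτ.2])
      have h2 : ∫ r in s₀..(s₀ + τ), c r ≤ C * τ := by
        have := intervalIntegral.integral_mono_on (by linarith [hτ.1])
          (hint s₀ (s₀ + τ) hs₀ (by linarith [hτ.1]) (by linarith [hτ.2])) intervalIntegrable_const
          (fun u hu => hcC u ⟨hu.1, hu.2.trans (by linarith [hτ.2])⟩)
        rwa [intervalIntegral.integral_const, smul_eq_mul, show (s₀ + τ - s₀) * C = C * τ by ring] at this
      linarith
    intro τ hτ y hy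
    exact KidderKnobMelnikov.stub_coneLocality.eq_of_cone hJ hζ hab ha hγ
      (P₁ := fun s y => P₁ (s₀ + s) y) (Θ₁ := fun s y => Θ₁ (s₀ + s) y) (P₂ := fun s y => P₂ (s₀ + s) y)
      (Θ₂ := fun s y => Θ₂ (s₀ + s) y) (U₁ := fun s y => U₁ (s₀ + s) y) (U₂ := fun s y => U₂ (s₀ + s) y)
      (contDiffOn_timeShift hs₀ hht hP₁) (contDiffOn_timeShift hs₀ hht hΘ₁) (contDiffOn_timeShift hs₀ hht hU₁)
      (contDiffOn_timeShift hs₀ hht hP₂) (contDiffOn_timeShift hs₀ hht hΘ₂) (contDiffOn_timeShift hs₀ hht hU₂)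
      (fun σ hσ z hz => hrange (s₀ + σ) ⟨by linarith [hσ.1], by linarith [hσ.2]⟩ z (region σ hσ z hz))
      (fun σ hσ z hz => by
        obtain ⟨e1, e2⟩ := hE (s₀ + σ) ⟨by linarith [hσ.1], by linarith [hσ.2]⟩ z
          (region σ (Set.Ioo_subset_Ico_self hσ) z hz)
        exact ⟨(athermalEulerAt_timeShift ζ P₁ Θ₁ U₁ s₀ σ z).2 e1,
          (athermalEulerAt_timeShift ζ P₂ Θ₂ U₂ s₀ σ z).2 e2⟩)
      hC
      (fun σ hσ z hz => (hspeed (s₀ + σ) ⟨by linarith [hσ.1], by linarith [hσ.2]⟩ z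
          (region σ (Set.Ioo_subset_Ico_self hσ) z hz)).trans
        (hcC (s₀ + σ) ⟨by linarith [hσ.1], by linarith [hσ.2]⟩))
      (fun z hz => by simpa only [add_zero] using hagr z hz)
      hτ hy
  -- a margin `δ > 0` with `‖x - x₀‖ + ∫₀ᵗ c + δ t < R`
  obtain ⟨δ, hδ, hδx⟩ : ∃ δ : ℝ, 0 < δ ∧ ‖x - x₀‖ + (∫ r in (0 : ℝ)..t, c r) + δ * t < R := by
    have hgpos : 0 < R - ‖x - x₀‖ - ∫ r in (0 : ℝ)..t, c r := by linarith
    have ht1 : (0 : ℝ) < t + 1 := by linarith [ht.1]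
    refine ⟨(R - ‖x - x₀‖ - ∫ r in (0 : ℝ)..t, c r) / (t + 1), div_pos hgpos ht1, ?_⟩
    have h1 : (R - ‖x - x₀‖ - ∫ r in (0 : ℝ)..t, c r) / (t + 1) * t <
        (R - ‖x - x₀‖ - ∫ r in (0 : ℝ)..t, c r) / (t + 1) * (t + 1) :=
      mul_lt_mul_of_pos_left (by linarith) (div_pos hgpos ht1)
    rw [div_mul_cancel₀ _ ht1.ne'] at h1
    linarith
  -- `good s`: agreement at time `s` on the ball of radius `R - ∫₀ˢ c - δ s`
  set good : ℝ → Prop := fun s => ∀ y : V3, ‖y - x₀‖ + (∫ r in (0 : ℝ)..s, c r) + δ * s < R →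
    P₁ s y = P₂ s y ∧ U₁ s y = U₂ s y ∧ Θ₁ s y = Θ₂ s y
  have good0 : good 0 := fun y hy => h0 y (by simpa using hy)
  -- OPEN STEP: `good` propagates a little to the right of any `s < t₁`
  have opn : ∀ s ∈ Set.Ico 0 t₁, good s → ∃ h > 0, ∀ s' ∈ Set.Ico s (s + h), good s' := by
    intro s hs hgs
    obtain ⟨η, hη, hηc⟩ := Metric.continuousWithinAt_iff.1 (hcc s ⟨hs.1, hs.2.le⟩) (δ / 2) (by positivity)
    have hhpos : 0 < min (η / 2) ((t₁ - s) / 2) := lt_min (by positivity) (by linarith [hs.2])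
    refine ⟨min (η / 2) ((t₁ - s) / 2), hhpos, ?_⟩
    set h := min (η / 2) ((t₁ - s) / 2)
    have hh₁ : h ≤ η / 2 := min_le_left _ _
    have hh₂ : h ≤ (t₁ - s) / 2 := min_le_right _ _
    have hcs0 : 0 ≤ c s := hc0 s ⟨hs.1, hs.2.le⟩
    -- two-sided bound of `c` on the piece `[s, s + h]`
    have hcb : ∀ s' ∈ Set.Icc s (s + h), c s - δ / 2 ≤ c s' ∧ c s' ≤ c s + δ / 2 := by
      intro s' hs'
      have h1 : s' ∈ Set.Icc 0 t₁ := ⟨hs.1.trans hs'.1, by linarith [hs'.2]⟩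
      have h2 : dist s' s < η := by
        rw [Real.dist_eq, abs_of_nonneg (by linarith [hs'.1])]; linarith [hs'.2]
      have h3 := hηc h1 h2
      rw [Real.dist_eq, abs_lt] at h3
      constructor <;> linarith [h3.1, h3.2]
    have hst := step s (R - (∫ r in (0 : ℝ)..s, c r) - δ * s) (c s + δ / 2) h hs.1 hhpos (by linarith)
      (by positivity) (fun s' hs' => (hcb s' hs').2) (by nlinarith [hs.1, hδ]) fun y hy => hgs y (by linarith)
    intro s' hs' y hy
    obtain ⟨τ, rfl⟩ : ∃ τ, s' = s + τ := ⟨s' - s, by ring⟩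
    have hτ : τ ∈ Set.Ico 0 h := ⟨by linarith [hs'.1], by linarith [hs'.2]⟩
    refine hst τ hτ y ?_
    have h1 := hadd s (s + τ) hs.1 (by linarith [hτ.1]) (by linarith [hτ.2])
    have h2 : (c s - δ / 2) * τ ≤ ∫ r in s..(s + τ), c r := by
      have := intervalIntegral.integral_mono_on (by linarith [hτ.1]) intervalIntegrable_const
        (hint s (s + τ) hs.1 (by linarith [hτ.1]) (by linarith [hτ.2]))
        (fun u hu => (hcb u ⟨hu.1, hu.2.trans (by linarith [hτ.2])⟩).1)
      rwa [intervalIntegral.integral_const, smul_eq_mul,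
        show (s + τ - s) * (c s - δ / 2) = (c s - δ / 2) * τ by ring] at this
    linarith
  -- CLOSED STEP: `good` on `[0, s)` gives `good s` (`0 < s < t₁`), by left-continuity in time
  have cls : ∀ s ∈ Set.Ioo 0 t₁, (∀ s' ∈ Set.Ico 0 s, good s') → good s := by
    intro s hs hgs y hy
    have hA : ∀ s' ∈ Set.Ico 0 s, P₁ s' y = P₂ s' y ∧ U₁ s' y = U₂ s' y ∧ Θ₁ s' y = Θ₂ s' y := by
      intro s' hs'
      refine hgs s' hs' y ?_
      have h1 := hadd s' s hs'.1 hs'.2.le hs.2.le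
      have h2 : 0 ≤ ∫ r in s'..s, c r :=
        intervalIntegral.integral_nonneg hs'.2.le fun u hu => hc0 u ⟨hs'.1.trans hu.1, hu.2.trans hs.2.le⟩
      have h3 : δ * s' ≤ δ * s := mul_le_mul_of_nonneg_left hs'.2.le hδ.le
      linarith
    exact ⟨eq_of_eqOn_Ico hP₁.continuousOn hP₂.continuousOn hs fun s' hs' => (hA s' hs').1,
      eq_of_eqOn_Ico hU₁.continuousOn hU₂.continuousOn hs fun s' hs' => (hA s' hs').2.1,
      eq_of_eqOn_Ico hΘ₁.continuousOn hΘ₂.continuousOn hs fun s' hs' => (hA s' hs').2.2⟩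
  -- REAL INDUCTION on `[0, t]`
  have key : ∀ s ∈ Set.Icc 0 t, good s := by
    set A : Set ℝ := {s | s ∈ Set.Icc 0 t ∧ ∀ s' ∈ Set.Icc 0 s, good s'}
    have h0A : (0 : ℝ) ∈ A := by
      refine ⟨⟨le_rfl, ht.1⟩, fun s' hs' => ?_⟩
      obtain rfl : s' = 0 := le_antisymm hs'.2 hs'.1
      exact good0
    have hne : A.Nonempty := ⟨0, h0A⟩
    have hbdd : BddAbove A := ⟨t, fun s hs => hs.1.2⟩
    have hm0 : 0 ≤ sSup A := le_csSup hbdd h0A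
    have hmt : sSup A ≤ t := csSup_le hne fun s hs => hs.1.2
    have hmt₁ : sSup A < t₁ := hmt.trans_lt ht.2
    have below : ∀ s' ∈ Set.Ico 0 (sSup A), good s' := fun s' hs' => by
      obtain ⟨a', ha'A, hs'a'⟩ := exists_lt_of_lt_csSup hne hs'.2
      exact ha'A.2 s' ⟨hs'.1, hs'a'.le⟩
    have goodm : good (sSup A) := by
      rcases hm0.eq_or_lt with h | h
      · rw [← h]; exact good0
      · exact cls _ ⟨h, hmt₁⟩ below
    have uptom : ∀ s' ∈ Set.Icc 0 (sSup A), good s' := fun s' hs' =>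
      (hs'.2.eq_or_lt).elim (fun e => by rw [e]; exact goodm) fun hlt => below s' ⟨hs'.1, hlt⟩
    -- `sSup A = t`, or the open step produces a larger element of `A`
    have hmeq : sSup A = t := by
      by_contra hne'
      have hlt : sSup A < t := lt_of_le_of_ne hmt hne'
      obtain ⟨h, hh, hgood'⟩ := opn _ ⟨hm0, hmt₁⟩ goodm
      have hm'A : min t (sSup A + h / 2) ∈ A := by
        refine ⟨⟨le_min ht.1 (by linarith), min_le_left _ _⟩, fun s' hs' => ?_⟩
        rcases le_or_gt s' (sSup A) with h1 | h1
        · exact uptom s' ⟨hs'.1, h1⟩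
        · exact hgood' s' ⟨h1.le, (hs'.2.trans (min_le_right _ _)).trans_lt (by linarith)⟩
      have h3 := le_csSup hbdd hm'A
      have h2 : sSup A < min t (sSup A + h / 2) := lt_min hlt (by linarith)
      linarith
    intro s hs
    rw [← hmeq] at hs
    exact uptom s hs
  exact key t ⟨ht.1, le_rfl⟩ x hδx

end Summit.AtomisticToContinuum.HydrodynamicLimit.Theorems.R2OneModeTwoConditions

end
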